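import Literature.AlgebraicGeometry.Resolution.StrictNormalCrossingsAt
import Literature.AlgebraicGeometry.Resolution.FormalNormalCrossingsLemmas
import Literature.AlgebraicGeometry.Motives.VarietiesRegularProofs
import HarnessLib

/-!
# The formal-to-étale bridge, algebraic core: strict normal crossings from an étale solution of
the coordinate equations

Topic: `Literature/AlgebraicGeometry/Resolution`. For de Jong 1996, 4.25 (i)/4.28
(`DeJong1996FormalNormalCrossings`, via Artin approximation `Artin1969EtaleApproximation`): the
formal description `(𝒪̂_{X,x}, Î_Z) ≅ (k⟦x₁, …, x_d⟧, (x₁ ⋯ x_r))` of a divisor `Z` at a point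
`x` yields a solution, in the completion, of the following system of polynomial equations with
coefficients in an affine chart `R = Γ(X, W)` (`g₁, …, g_m` generators of `I_Z(W)`,
`t₁, …, t_n` generators of the prime `𝔭` of `x`, unknowns `y, a, b, c, d`):

  (E1) `g_j = a_j · ∏_{i < r} y_i`,  (E2) `∏_{i < r} y_i = ∑_j b_j g_j`,
  (E3) `t_l = ∑_i c_{li} y_i`,      (E4) `y_i = ∑_l d_{il} t_l`.

Artin's theorem then gives a solution in an étale neighbourhood, i.e. in an étale `R`-algebra
`R'` at a prime `𝔮` over `𝔭`. This file PROVES the purely algebraic consequence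
(`isSNCIdeal_radical_of_etale_solution`): if `R → R'` is étale, `𝔮` a prime of `R'` over
`𝔭 = (t₁, …, t_n)`, `R_𝔭` regular of dimension `d ≥ r ≥ 1`, and `y, a, b, c, d ∈ R'` solve
(E1)–(E4), then the radical of `I R'_𝔮`, `I = (g₁, …, g_m)`, has local strict normal crossings
data (`IsSNCIdeal`): `R'_𝔮` is regular (étale over regular), `𝔪_{R'_𝔮} = 𝔭 R'_𝔮` (unramified)
`= (y₁, …, y_d)` by (E3)–(E4), `dim R'_𝔮 = ht 𝔮 = ht 𝔭 = d` (étale maps preserve heights), so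
`y` is a regular system of parameters; `I R'_𝔮 = (∏_{i<r} yᵢ)` by (E1)–(E2), a radical ideal.

## Sources

* A. J. de Jong, *Smoothness, semi-stability and alterations*, Publ. Math. IHÉS 83 (1996),
  4.25–4.28 (the situation), 2.4.
* M. Artin, *Algebraic approximation of structures over complete local rings*, Publ. Math.
  IHÉS 36 (1969), Cor. 2.1 (the use of the system).
* The Stacks Project, Tags 00TV, 00ON (étale over regular is regular; heights), 0BI9.
-/

noncomputable section

open IsLocalRing

universe u

namespace Literature.AlgebraicGeometry.Resolution

/-! ## Reindexing the first `r` of `d` indices -/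

/-- The first `r` indices of `Fin d` as the image of `Fin r`. [folklore] -/
theorem Finset.filter_val_lt_eq_map_castLEEmb {d r : ℕ} (hrd : r ≤ d) :
    (Finset.univ.filter fun i : Fin d => (i : ℕ) < r) = Finset.univ.map (Fin.castLEEmb hrd) := by
  ext i
  simp only [Finset.mem_filter, Finset.mem_univ, true_and, Finset.mem_map, Fin.castLEEmb_apply]
  constructor
  · intro hi
    exact ⟨⟨i, hi⟩, Fin.ext rfl⟩
  · rintro ⟨j, rfl⟩
    exact j.2

/-- Products over the first `r` of `d` indices are products over `Fin r`. [folklore] -/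
theorem Finset.prod_filter_val_lt {M : Type*} [CommMonoid M] {d r : ℕ} (hrd : r ≤ d)
    (F : Fin d → M) :
    ∏ i ∈ Finset.univ.filter (fun i : Fin d => (i : ℕ) < r), F i = ∏ i : Fin r, F (Fin.castLE hrd i) := by
  rw [Finset.filter_val_lt_eq_map_castLEEmb hrd, Finset.prod_map]
  rfl

/-! ## Regular systems of parameters from generators of the maximal ideal -/

/-- In a regular local ring of dimension `d`, any `d` generators of `𝔪` have linearly
independent differentials (they form a regular system of parameters). [folklore] -/
theorem linearIndependent_toCotangent_of_span_eq_maximalIdeal {B : Type u} [CommRing B]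
    [IsRegularLocalRing B] {d : ℕ} (hdim : ringKrullDim B = d) (y : Fin d → B)
    (hspan : Ideal.span (Set.range y) = maximalIdeal B) :
    LinearIndependent (ResidueField B) fun i =>
      (maximalIdeal B).toCotangent ⟨y i, hspan ▸ Ideal.subset_span ⟨i, rfl⟩⟩ := by
  have hd : (maximalIdeal B).spanFinrank = d := by
    have h := IsRegularLocalRing.spanFinrank_maximalIdeal (R := B)
    rw [hdim] at h
    exact_mod_cast h
  rw [linearIndependent_toCotangent_iff_forall_mem]
  exact fun c hc i => mem_maximalIdeal_of_sum_mul_rsop_mem_sq hd y hspan c hc i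

/-! ## The algebraic core -/

section Core

variable {R R' : Type u} [CommRing R] [CommRing R'] [Algebra R R']

/-- **Étale over a regular local ring is regular**, for arbitrary models of the localisations
(tree `IsRegularLocalRing.of_etale`, Stacks 00TV). [cite: StacksProject, Tag 00TV] -/
theorem isRegularLocalRing_of_etale_atPrime [IsNoetherianRing R] [Algebra.Etale R R']
    (𝔮 : Ideal R') [𝔮.IsPrime] (A B : Type u) [CommRing A] [CommRing B] [Algebra R A]
    [Algebra R' B] [IsRegularLocalRing A] [IsLocalization.AtPrime A (𝔮.under R)]
    [IsLocalization.AtPrime B 𝔮] : IsRegularLocalRing B := by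
  haveI := IsLocalization.AtPrime.isLocalRing B 𝔮
  haveI : IsRegularLocalRing (Localization.AtPrime (𝔮.under R)) :=
    IsRegularLocalRing.of_ringEquiv
      (IsLocalization.algEquiv (𝔮.under R).primeCompl A (Localization.AtPrime (𝔮.under R))).toRingEquiv
  haveI : IsRegularLocalRing (Localization.AtPrime 𝔮) :=
    Literature.AlgebraicGeometry.Motives.IsRegularLocalRing.of_etale (R := R) 𝔮
  exact IsRegularLocalRing.of_ringEquiv
    (IsLocalization.algEquiv 𝔮.primeCompl (Localization.AtPrime 𝔮) B).toRingEquiv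

/-- **Étale local homomorphisms are unramified**: `𝔭 R'_𝔮 = 𝔪_{R'_𝔮}` for a prime `𝔮` of the
étale `R`-algebra `R'` over `𝔭` (Mathlib `Algebra.isUnramifiedAt_iff_map_eq`).
[cite: StacksProject, Tag 00UW] -/
theorem map_under_eq_maximalIdeal_localization_of_etale [Algebra.Etale R R'] (𝔮 : Ideal R')
    [𝔮.IsPrime] :
    (𝔮.under R).map (algebraMap R (Localization.AtPrime 𝔮)) = maximalIdeal _ := by
  haveI : 𝔮.LiesOver (𝔮.under R) := ⟨rfl⟩
  letI := Localization.AtPrime.algebraOfLiesOver (𝔮.under R) 𝔮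
  have hunr : Algebra.IsUnramifiedAt R 𝔮 := inferInstance
  exact ((Algebra.isUnramifiedAt_iff_map_eq R (𝔮.under R) 𝔮).1 hunr).2

/-- Hence `(𝔭 R') R'_𝔮 = 𝔮 R'_𝔮`. [cite: StacksProject, Tag 00UW] -/
theorem map_map_under_localization_eq_of_etale [Algebra.Etale R R'] (𝔮 : Ideal R') [𝔮.IsPrime] :
    ((𝔮.under R).map (algebraMap R R')).map (algebraMap R' (Localization.AtPrime 𝔮)) =
      𝔮.map (algebraMap R' (Localization.AtPrime 𝔮)) := by
  rw [Ideal.map_map, ← IsScalarTower.algebraMap_eq, map_under_eq_maximalIdeal_localization_of_etale,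
    Localization.AtPrime.map_eq_maximalIdeal]

/-- The same for an arbitrary model `B` of the localisation of `R'` at `𝔮` (extended ideals only
depend on saturations): `(𝔭 R') B = 𝔪_B`. [cite: StacksProject, Tag 00UW] -/
theorem map_under_eq_maximalIdeal_of_etale_atPrime [Algebra.Etale R R'] (𝔮 : Ideal R')
    [𝔮.IsPrime] (B : Type u) [CommRing B] [Algebra R' B] [IsLocalRing B]
    [IsLocalization.AtPrime B 𝔮] :
    ((𝔮.under R).map (algebraMap R R')).map (algebraMap R' B) = maximalIdeal B := by
  apply le_antisymm
  · rw [← IsLocalization.AtPrime.map_eq_maximalIdeal 𝔮 B]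
    exact Ideal.map_mono (Ideal.map_le_iff_le_comap.mpr le_rfl)
  · rw [← IsLocalization.AtPrime.map_eq_maximalIdeal 𝔮 B, Ideal.map_le_iff_le_comap]
    intro z hz
    have hz' : algebraMap R' (Localization.AtPrime 𝔮) z ∈
        ((𝔮.under R).map (algebraMap R R')).map (algebraMap R' (Localization.AtPrime 𝔮)) := by
      rw [map_map_under_localization_eq_of_etale]
      exact Ideal.mem_map_of_mem _ hz
    obtain ⟨m, hm, hmz⟩ :=
      (IsLocalization.algebraMap_mem_map_algebraMap_iff 𝔮.primeCompl _ _ z).mp hz'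
    exact (IsLocalization.algebraMap_mem_map_algebraMap_iff 𝔮.primeCompl B _ z).mpr ⟨m, hm, hmz⟩

/-- **Étale maps preserve dimensions of local rings**: `dim B = dim A` for localisations at a
prime `𝔮` and at `𝔭 = 𝔮 ∩ R` (heights are preserved, tree
`Ideal.height_eq_height_under_of_etale_of_isPrime`, Stacks 00ON). [cite: StacksProject, Tag 00ON] -/
theorem ringKrullDim_eq_of_etale_atPrime [IsNoetherianRing R] [Algebra.Etale R R']
    (𝔮 : Ideal R') [𝔮.IsPrime] (A B : Type u) [CommRing A] [CommRing B] [Algebra R A]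
    [Algebra R' B] [IsLocalization.AtPrime A (𝔮.under R)] [IsLocalization.AtPrime B 𝔮] :
    ringKrullDim B = ringKrullDim A := by
  rw [IsLocalization.AtPrime.ringKrullDim_eq_height 𝔮 B,
    Literature.AlgebraicGeometry.Motives.Ideal.height_eq_height_under_of_etale_of_isPrime (R := R) 𝔮,
    ← IsLocalization.AtPrime.ringKrullDim_eq_height (𝔮.under R) A]

/-- **Strict normal crossings from an étale solution of (E1)–(E4)** (see the module docstring).
[folklore] -/
theorem isSNCIdeal_radical_of_etale_solution [IsNoetherianRing R] [Algebra.Etale R R']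
    (𝔮 : Ideal R') [𝔮.IsPrime] (A B : Type u) [CommRing A] [CommRing B] [Algebra R A]
    [Algebra R' B] [IsRegularLocalRing A] [IsLocalization.AtPrime A (𝔮.under R)] [IsLocalRing B]
    [IsLocalization.AtPrime B 𝔮] {d r m n : ℕ} (hdim : ringKrullDim A = d) (hr : 1 ≤ r)
    (hrd : r ≤ d) (gI : Fin m → R) (t : Fin n → R) (ht : Ideal.span (Set.range t) = 𝔮.under R)
    (y : Fin d → R') (a b : Fin m → R') (c : Fin n → Fin d → R') (dd : Fin d → Fin n → R')
    (hE1 : ∀ j, algebraMap R R' (gI j) =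
      a j * ∏ i ∈ Finset.univ.filter (fun i : Fin d => (i : ℕ) < r), y i)
    (hE2 : ∏ i ∈ Finset.univ.filter (fun i : Fin d => (i : ℕ) < r), y i =
      ∑ j, b j * algebraMap R R' (gI j))
    (hE3 : ∀ l, algebraMap R R' (t l) = ∑ i, c l i * y i)
    (hE4 : ∀ i, y i = ∑ l, dd i l * algebraMap R R' (t l)) :
    IsSNCIdeal (((Ideal.span (Set.range gI)).map (algebraMap R R')).map
      (algebraMap R' B)).radical := by
  classical
  /- (1) `B` is regular -/
  haveI hregB : IsRegularLocalRing B := isRegularLocalRing_of_etale_atPrime (R := R) 𝔮 A B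
  /- (2) `𝔪_B = 𝔭 B` -/
  have hmaxB : ((Ideal.span (Set.range t)).map (algebraMap R R')).map (algebraMap R' B) =
      maximalIdeal B := by
    rw [ht]
    exact map_under_eq_maximalIdeal_of_etale_atPrime (R := R) 𝔮 B
  /- (3) `𝔪_B = (y₁, …, y_d)` by (E3), (E4) -/
  let y' : Fin d → B := fun i => algebraMap R' B (y i)
  have hspan : Ideal.span (Set.range y') = maximalIdeal B := by
    rw [← hmaxB, Ideal.map_map, Ideal.map_span, ← Set.range_comp]
    apply le_antisymm
    · rw [Ideal.span_le]
      rintro _ ⟨i, rfl⟩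
      have : y' i = ∑ l, algebraMap R' B (dd i l) * ((algebraMap R' B).comp (algebraMap R R')) (t l) := by
        simp only [y', hE4 i, map_sum, map_mul, RingHom.comp_apply]
      rw [SetLike.mem_coe, this]
      exact Ideal.sum_mem _ fun l _ => Ideal.mul_mem_left _ _ (Ideal.subset_span ⟨l, rfl⟩)
    · rw [Ideal.span_le]
      rintro _ ⟨l, rfl⟩
      have : ((algebraMap R' B).comp (algebraMap R R')) (t l) =
          ∑ i, algebraMap R' B (c l i) * y' i := by
        simp only [y', RingHom.comp_apply, hE3 l, map_sum, map_mul]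
      rw [SetLike.mem_coe, Function.comp_apply, this]
      exact Ideal.sum_mem _ fun i _ => Ideal.mul_mem_left _ _ (Ideal.subset_span ⟨i, rfl⟩)
  /- (4) `dim B = d` -/
  have hdimB : ringKrullDim B = d := (ringKrullDim_eq_of_etale_atPrime (R := R) 𝔮 A B).trans hdim
  /- (5) `y` is a regular system of parameters; its first `r` members -/
  have hd : (maximalIdeal B).spanFinrank = d := by
    have h := IsRegularLocalRing.spanFinrank_maximalIdeal (R := B)
    rw [hdimB] at h
    exact_mod_cast h
  have hx' : ∀ i : Fin r, y' (Fin.castLE hrd i) ∈ maximalIdeal B := fun i =>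
    hspan ▸ Ideal.subset_span ⟨_, rfl⟩
  have hli' : LinearIndependent (ResidueField B)
      fun i : Fin r => (maximalIdeal B).toCotangent ⟨y' (Fin.castLE hrd i), hx' i⟩ := by
    -- (stated directly through the relation criterion: independence of the whole system `y`
    -- restricts to the sub-family by extending coefficients by zero)
    rw [linearIndependent_toCotangent_iff_forall_mem]
    intro c hc i
    let c' : Fin d → B := fun j => if h : (j : ℕ) < r then c ⟨j, h⟩ else 0
    have hsum : ∑ j, c' j * y' j = ∑ i : Fin r, c i * y' (Fin.castLE hrd i) := by
      rw [← Finset.sum_filter_add_sum_filter_not Finset.univ (fun j : Fin d => (j : ℕ) < r)]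
      have h0 : ∑ j ∈ Finset.univ.filter (fun j : Fin d => ¬ (j : ℕ) < r), c' j * y' j = 0 :=
        Finset.sum_eq_zero fun j hj => by
          simp only [Finset.mem_filter] at hj
          simp [c', hj.2]
      rw [h0, add_zero, Finset.filter_val_lt_eq_map_castLEEmb hrd, Finset.sum_map]
      refine Finset.sum_congr rfl fun i _ => ?_
      simp [c', Fin.castLEEmb_apply]
    have hc' : ∑ j, c' j * y' j ∈ (maximalIdeal B) ^ 2 := hsum ▸ hc
    have := mem_maximalIdeal_of_sum_mul_rsop_mem_sq hd y' hspan c' hc' (Fin.castLE hrd i)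
    simpa [c'] using this
  /- (6) the ideal: `I B = (∏_{i<r} y_i) B` by (E1), (E2) -/
  have hprod : ∏ i ∈ Finset.univ.filter (fun i : Fin d => (i : ℕ) < r), y' i =
      ∏ i : Fin r, y' (Fin.castLE hrd i) :=
    Finset.prod_filter_val_lt hrd y'
  have hprod' : algebraMap R' B (∏ i ∈ Finset.univ.filter (fun i : Fin d => (i : ℕ) < r), y i) =
      ∏ i : Fin r, y' (Fin.castLE hrd i) := by
    rw [map_prod]
    exact hprod
  have hIB : ((Ideal.span (Set.range gI)).map (algebraMap R R')).map (algebraMap R' B) =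
      Ideal.span {∏ i : Fin r, y' (Fin.castLE hrd i)} := by
    rw [Ideal.map_map, Ideal.map_span, ← Set.range_comp]
    apply le_antisymm
    · rw [Ideal.span_le]
      rintro _ ⟨j, rfl⟩
      rw [SetLike.mem_coe, Function.comp_apply, RingHom.comp_apply, hE1 j, map_mul, hprod']
      exact Ideal.mul_mem_left _ _ (Ideal.mem_span_singleton_self _)
    · rw [Ideal.span_singleton_le_iff_mem, ← hprod', hE2, map_sum]
      refine Ideal.sum_mem _ fun j _ => ?_
      rw [map_mul]
      exact Ideal.mul_mem_left _ _ (Ideal.subset_span ⟨j, rfl⟩)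
  rw [hIB, radical_span_singleton_prod_of_linearIndependent_toCotangent _ hx' hli']
  exact IsSNCIdeal.of_linearIndependent hr _ hx' hli' rfl

end Core

end Literature.AlgebraicGeometry.Resolution

end
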